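import Summits.CriticalPhenomena.SAWScalingLimit.Theorems.SAWReversalUpgradeAttachReversalPlateau
import Summits.CriticalPhenomena.SAWScalingLimit.Theorems.SAWReversalUpgradeAttachReversalAssemblyA
import Literature.Probability.RandomPlanarGeometry.SimpleCurveLaws

/-!
# Attachment reversal (`AttachReversal`, stmt-CriticalPhenomena-18007): the repaired theorem

Route `SAWReversalUpgrade`, support item `AttachReversal`: if `c` is the standard attachment for
`(D; a, b, φ)` and the polyline of a self-avoiding walk `γ`, and `c'` the standard attachment for the
swapped domain `(D; b, a, φ')` and the polyline of the reversed walk, then `mk c' = reverse (mk c)` in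
`CurveClass ℂ`.

`attachReversal_of_mem_closure` proves this for every walk whose starting mesh point lies in
`closure D` — automatic for walks of positive length (their vertices are in the discrete domain
`Ω_δ ⊆ D`), and the natural side condition for the trivial walk. WITHOUT it the route's literal
statement `AttachReversal` quantifies also over the trivial walk sitting at a lattice point OUTSIDE
`closure D`, where the attachment data are junk values of `Function.invFunOn` (an unspecified
`Classical.choice`), on which nothing can be proved; see the item's release note (`misstated`) and
`attachReversal_iff` (Defs file) for the definitional reading of the route's `let`-blocks used here.

Proof: `range c' = range c` (then two injective curves with the same trace and exchanged endpoints
define reversed classes, `CurveClass.eq_of_mem_simple_of_range_eq`). The two ranges are prescribed by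
the attachment data of `R = U ∘ h` in `(D; a, b, φ)` and of `R' = (U ∘ (1 - ·)) ∘ h` in `(D; b, a, φ')`
(`U` the uniform polyline, `h` the dyadic time change — file AssemblyA); the data are invariant under
`h` (file Invariance), exactly symmetric under `U ↦ U ∘ (1 - ·)` with the swap (files ReversalA–C:
the squeeze commutes with `z ↦ -1/(cz)`, by which the two uniformizers differ), and strictness of the
cut-time condition survives the plateau of `h` (file Plateau).
-/

noncomputable section

open Set Function Filter Topology Complex
open UpperHalfPlane (upperHalfPlaneSet)
open Literature.Probability.RandomPlanarGeometry Literature.Probability.LatticeModels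
open Literature.Probability.Percolation (dyadicTime)

namespace Summit.CriticalPhenomena.SAWScalingLimit.Theorems.AttachReversal

/-! ### From the attachment data to the ranges, and from the ranges to the classes -/

/-- Two standard attachments whose cut-time conditions agree and whose prescribed traces agree have
the same range. -/
theorem range_eq_of_data {a b a' b' : ℂ} {Φ Φ' : ℂ → ℂ} {e : ℝ} {R R' : ℝ → ℂ} {Ω Ω' : Set ℂ}
    {c c' : Curve ℂ} (hc : c ∈ standardCurves a b Φ e R Ω) (hc' : c' ∈ standardCurves a' b' Φ' e R' Ω')
    (hiff : uMid a' b' Φ' e R' < vMid a' b' Φ' e R' ↔ uMid a b Φ e R < vMid a b Φ e R)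
    (hS : uMid a b Φ e R < vMid a b Φ e R → attSet a' b' Φ' e R' = attSet a b Φ e R)
    (hF : fallback a' b' Φ' = fallback a b Φ) : Set.range c' = Set.range c := by
  obtain ⟨-, -, -, -, h5, h6⟩ := hc
  obtain ⟨-, -, -, -, h5', h6'⟩ := hc'
  by_cases hlt : uMid a b Φ e R < vMid a b Φ e R
  · rw [h5 hlt, h5' (hiff.2 hlt), hS hlt]
  · rw [h6 hlt, h6' (fun h => hlt (hiff.1 h)), hF]

/-- **Two injective curves with the same trace and exchanged endpoints define reversed classes.** -/
theorem mk_eq_reverse_of_range_eq {b : ℂ} {c c' : Curve ℂ} (hinj : Injective c) (hinj' : Injective c')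
    (htgt : c.target = b) (hsrc' : c'.source = b) (hrange : Set.range c' = Set.range c) :
    CurveClass.mk c' = (CurveClass.mk c).reverse := by
  rw [CurveClass.reverse_mk]
  refine CurveClass.eq_of_mem_simple_of_range_eq (CurveClass.mk_mem_simple hinj')
    (CurveClass.mk_mem_simple (Curve.IsSimple.reverse hinj)) ?_ ?_
  · rw [CurveClass.range_mk, CurveClass.range_mk, Curve.range_reverse]
    exact hrange
  · rw [CurveClass.source_mk, CurveClass.source_mk, Curve.source_reverse, hsrc', htgt]

/-! ### The attachment data of the walk and of its reversal agree -/

variable {D : DobrushinDomain} {φ : ConformalEquiv upperHalfPlaneSet D.carrier}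
  {φ' : ConformalEquiv upperHalfPlaneSet D.swap.carrier}

/-- **The data agree** (cut-time condition, prescribed trace, fallback trace) for the polyline of a
walk in `(D; a, b, φ)` and the polyline of the reversed walk in `(D; b, a, φ')`, provided the starting
mesh point lies in `closure D`. -/
theorem data_agree (hφ : D.IsChordalUniformizing φ) (hφ' : D.swap.IsChordalUniformizing φ') {δ : ℝ}
    {u v : Site 2} (γ : SAW.DomainSAW D.carrier δ u v) (hδ : 0 < δ) (hu : meshPoint δ u ∈ closure D.carrier) :
    (uMid (D.pt 1) (D.pt 0) φ'.boundaryExtension (min δ (1/2)) (projLine (γ.walk.reverse.toCurve (meshPoint δ))) <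
        vMid (D.pt 1) (D.pt 0) φ'.boundaryExtension (min δ (1/2)) (projLine (γ.walk.reverse.toCurve (meshPoint δ))) ↔
      uMid (D.pt 0) (D.pt 1) φ.boundaryExtension (min δ (1/2)) (projLine (γ.walk.toCurve (meshPoint δ))) <
        vMid (D.pt 0) (D.pt 1) φ.boundaryExtension (min δ (1/2)) (projLine (γ.walk.toCurve (meshPoint δ)))) ∧
    (uMid (D.pt 0) (D.pt 1) φ.boundaryExtension (min δ (1/2)) (projLine (γ.walk.toCurve (meshPoint δ))) <
        vMid (D.pt 0) (D.pt 1) φ.boundaryExtension (min δ (1/2)) (projLine (γ.walk.toCurve (meshPoint δ))) →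
      attSet (D.pt 1) (D.pt 0) φ'.boundaryExtension (min δ (1/2)) (projLine (γ.walk.reverse.toCurve (meshPoint δ))) =
        attSet (D.pt 0) (D.pt 1) φ.boundaryExtension (min δ (1/2)) (projLine (γ.walk.toCurve (meshPoint δ)))) ∧
    fallback (D.pt 1) (D.pt 0) φ'.boundaryExtension = fallback (D.pt 0) (D.pt 1) φ.boundaryExtension := by
  obtain ⟨c₀, hc₀, heq⟩ := exists_eqOn_swap hφ hφ'
  have he : 0 < min δ (1/2) := lt_min hδ (by norm_num)
  have he' : min δ (1/2) ≤ 1 / 2 := min_le_right _ _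
  have hab : D.pt 0 ≠ D.pt 1 := D.pt_injective.ne (by decide)
  have hF := rev_fallback (D := D) (φ := φ) (φ' := φ') hc₀ heq
  rcases Nat.eq_zero_or_pos γ.walk.length with h0 | hn
  · -- the trivial walk: both polylines are the constant `meshPoint δ u`
    obtain ⟨w, hw⟩ := γ
    dsimp only at h0 ⊢
    have huv := SimpleGraph.Walk.eq_of_length_eq_zero h0
    subst huv
    have hnil : w = SimpleGraph.Walk.nil :=
      SimpleGraph.Walk.eq_nil_iff_nil.2 (SimpleGraph.Walk.length_eq_zero_iff.1 h0)
    subst hnil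
    rw [SimpleGraph.Walk.reverse_nil, projLine_toCurve_nil]
    by_cases hma : meshPoint δ u = D.pt 0
    · rw [hma]
      have h1 : ¬ uMid (D.pt 0) (D.pt 1) φ.boundaryExtension (min δ (1/2)) (fun _ : ℝ => D.pt 0) <
          vMid (D.pt 0) (D.pt 1) φ.boundaryExtension (min δ (1/2)) (fun _ : ℝ => D.pt 0) :=
        not_lt_of_const_fst hab hφ.boundaryExtension_zero
          (by rw [hinv_apply]; exact FaithfulAttach.invFun_pt_zero hφ) (sqz_zero (squeeze_spec' _))
      have h2 := const_snd_uMid_vMid (Φ := φ'.boundaryExtension) (e := min δ (1/2)) hab.symm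
      refine ⟨?_, fun h => (h1 h).elim, hF⟩
      rw [h2.1, h2.2]
      exact ⟨fun h => (lt_irrefl _ h).elim, fun h => (h1 h).elim⟩
    by_cases hmb : meshPoint δ u = D.pt 1
    · rw [hmb]
      have h1 := const_snd_uMid_vMid (Φ := φ.boundaryExtension) (e := min δ (1/2)) hab
      have h2 : ¬ uMid (D.pt 1) (D.pt 0) φ'.boundaryExtension (min δ (1/2)) (fun _ : ℝ => D.pt 1) <
          vMid (D.pt 1) (D.pt 0) φ'.boundaryExtension (min δ (1/2)) (fun _ : ℝ => D.pt 1) :=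
        not_lt_of_const_fst hab.symm (bExt_swap_zero hφ')
          (by rw [hinv_apply]; exact invFunOn_bExt_swap_pt_one hφ') (sqz_zero (squeeze_spec' _))
      refine ⟨?_, fun h => ?_, hF⟩
      · rw [h1.1, h1.2]
        exact ⟨fun h => (h2 h).elim, fun h => (lt_irrefl _ h).elim⟩
      · rw [h1.1, h1.2] at h; exact (lt_irrefl _ h).elim
    -- constant polyline off the marked points: exact reversal applies verbatim
    exact rev_main (U := fun _ : ℝ => meshPoint δ u) hφ hφ' hc₀ heq he he' continuous_const (fun _ => hu) hmb hma
  -- a walk of positive length: `R = U ∘ h`, `R' = (U ∘ (1 - ·)) ∘ h`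
  rw [projLine_toCurve_eq γ.walk hn, projLine_toCurve_reverse_eq γ.walk hn]
  obtain ⟨l, hl, hlen⟩ := support_map_eq_cons γ.walk (meshPoint δ)
  have hn' : (0:ℝ) < γ.walk.length := by exact_mod_cast hn
  -- the uniform polyline `U` and its properties
  have hU : Continuous fun s : ℝ => Literature.Probability.Percolation.affineInterp (γ.walk.support.map (meshPoint δ))
      ((γ.walk.length : ℝ) * max 0 (min 1 s)) :=
    (Literature.Probability.Percolation.continuous_affineInterp _).comp (continuous_const.mul (continuous_const.max (continuous_const.min continuous_id)))
  have hclamp : ∀ s : ℝ, (γ.walk.length : ℝ) * max 0 (min 1 s) ∈ Icc (0:ℝ) γ.walk.length := fun s =>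
    ⟨mul_nonneg hn'.le (le_max_left _ _), mul_le_of_le_one_right hn'.le (max_le zero_le_one (min_le_left _ _))⟩
  have hcl : ∀ s : ℝ, Literature.Probability.Percolation.affineInterp (γ.walk.support.map (meshPoint δ)) ((γ.walk.length : ℝ) * max 0 (min 1 s)) ∈
      closure D.carrier := fun s => affineInterp_support_mem_closure γ.walk hu _ (hclamp s)
  have hU0 : (fun s : ℝ => Literature.Probability.Percolation.affineInterp (γ.walk.support.map (meshPoint δ)) ((γ.walk.length : ℝ) * max 0 (min 1 s))) 0 =
      meshPoint δ u := by
    simp only [min_eq_right (zero_le_one' ℝ), max_self, mul_zero, hl, Literature.Probability.Percolation.affineInterp_cons_zero]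
  have hU1 : (fun s : ℝ => Literature.Probability.Percolation.affineInterp (γ.walk.support.map (meshPoint δ)) ((γ.walk.length : ℝ) * max 0 (min 1 s))) 1 =
      meshPoint δ v := by
    simp only [min_self, max_eq_right (zero_le_one' ℝ), mul_one]
    exact affineInterp_support_length (meshPoint δ) γ.walk
  have hu_mem : meshPoint δ u ∈ D.carrier := meshPoint_start_mem γ.walk hn
  have hv_mem : meshPoint δ v ∈ D.carrier := meshPoint_end_mem γ.walk hn
  have h0b : (fun s : ℝ => Literature.Probability.Percolation.affineInterp (γ.walk.support.map (meshPoint δ)) ((γ.walk.length : ℝ) * max 0 (min 1 s))) 0 ≠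
      D.pt 1 := by rw [hU0]; exact fun h => MarkedDomain.pt_notMem_carrier D 1 (h ▸ hu_mem)
  have h1a : (fun s : ℝ => Literature.Probability.Percolation.affineInterp (γ.walk.support.map (meshPoint δ)) ((γ.walk.length : ℝ) * max 0 (min 1 s))) 1 ≠
      D.pt 0 := by rw [hU1]; exact fun h => MarkedDomain.pt_notMem_carrier D 0 (h ▸ hv_mem)
  have h01 : (fun s : ℝ => Literature.Probability.Percolation.affineInterp (γ.walk.support.map (meshPoint δ)) ((γ.walk.length : ℝ) * max 0 (min 1 s))) 0 ≠
      (fun s : ℝ => Literature.Probability.Percolation.affineInterp (γ.walk.support.map (meshPoint δ)) ((γ.walk.length : ℝ) * max 0 (min 1 s))) 1 := by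
    rw [hU0, hU1]
    exact fun h => ne_of_isPath_of_length_pos γ.walk γ.isPath hn (Mesh.meshPoint_injective hδ.ne' h)
  -- the time change `h`
  have hh := continuous_timeChange γ.walk.length
  have hmono := monotone_timeChange γ.walk.length
  have hh0 := timeChange_zero γ.walk.length
  have hh1 := timeChange_one hn
  have hplat := timeChange_plateau hn
  -- the reversed uniform polyline `U' = U ∘ (1 - ·)`, seen from `D.swap`
  have hU' : Continuous fun s : ℝ => Literature.Probability.Percolation.affineInterp (γ.walk.support.map (meshPoint δ))
      ((γ.walk.length : ℝ) * max 0 (min 1 (1 - s))) := hU.comp (continuous_sub_left (1:ℝ))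
  -- exact reversal between `U` and `U'`
  obtain ⟨hiff, hS, -⟩ := rev_main hφ hφ' hc₀ heq he he' hU hcl h0b h1a
  -- no end plateau, for `U` in `D` and for `U'` in `D.swap`
  have hNP : uMid (D.pt 0) (D.pt 1) φ.boundaryExtension (min δ (1/2))
      ((fun s : ℝ => Literature.Probability.Percolation.affineInterp (γ.walk.support.map (meshPoint δ)) ((γ.walk.length : ℝ) * max 0 (min 1 s))) ∘
        fun x : ℝ => dyadicTime γ.walk.length (max 0 (min 1 x)) / (γ.walk.length : ℝ)) <
      vMid (D.pt 0) (D.pt 1) φ.boundaryExtension (min δ (1/2))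
      ((fun s : ℝ => Literature.Probability.Percolation.affineInterp (γ.walk.support.map (meshPoint δ)) ((γ.walk.length : ℝ) * max 0 (min 1 s))) ∘
        fun x : ℝ => dyadicTime γ.walk.length (max 0 (min 1 x)) / (γ.walk.length : ℝ)) →
      uMid (D.pt 0) (D.pt 1) φ.boundaryExtension (min δ (1/2))
        (fun s : ℝ => Literature.Probability.Percolation.affineInterp (γ.walk.support.map (meshPoint δ)) ((γ.walk.length : ℝ) * max 0 (min 1 s))) <
      vMid (D.pt 0) (D.pt 1) φ.boundaryExtension (min δ (1/2))
        (fun s : ℝ => Literature.Probability.Percolation.affineInterp (γ.walk.support.map (meshPoint δ)) ((γ.walk.length : ℝ) * max 0 (min 1 s))) :=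
    lt_of_repar_lt hφ he he' hU hcl h0b h1a h01 hh hmono hh0 hh1 hplat
  have hNP' : uMid (D.pt 1) (D.pt 0) φ'.boundaryExtension (min δ (1/2))
      ((fun s : ℝ => Literature.Probability.Percolation.affineInterp (γ.walk.support.map (meshPoint δ)) ((γ.walk.length : ℝ) * max 0 (min 1 (1 - s)))) ∘
        fun x : ℝ => dyadicTime γ.walk.length (max 0 (min 1 x)) / (γ.walk.length : ℝ)) <
      vMid (D.pt 1) (D.pt 0) φ'.boundaryExtension (min δ (1/2))
      ((fun s : ℝ => Literature.Probability.Percolation.affineInterp (γ.walk.support.map (meshPoint δ)) ((γ.walk.length : ℝ) * max 0 (min 1 (1 - s)))) ∘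
        fun x : ℝ => dyadicTime γ.walk.length (max 0 (min 1 x)) / (γ.walk.length : ℝ)) →
      uMid (D.pt 1) (D.pt 0) φ'.boundaryExtension (min δ (1/2))
        (fun s : ℝ => Literature.Probability.Percolation.affineInterp (γ.walk.support.map (meshPoint δ)) ((γ.walk.length : ℝ) * max 0 (min 1 (1 - s)))) <
      vMid (D.pt 1) (D.pt 0) φ'.boundaryExtension (min δ (1/2))
        (fun s : ℝ => Literature.Probability.Percolation.affineInterp (γ.walk.support.map (meshPoint δ)) ((γ.walk.length : ℝ) * max 0 (min 1 (1 - s)))) := by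
    have h := lt_of_repar_lt (D := D.swap) (φ := φ') (e := min δ (1/2))
      (U := fun s : ℝ => Literature.Probability.Percolation.affineInterp (γ.walk.support.map (meshPoint δ)) ((γ.walk.length : ℝ) * max 0 (min 1 (1 - s))))
      hφ' he he' hU' (fun s => hcl (1 - s))
      (by rw [MarkedDomain.pt_swap_one]; simpa only [sub_zero] using h1a)
      (by rw [MarkedDomain.pt_swap_zero]; simpa only [sub_self] using h0b)
      (by simpa only [sub_zero, sub_self] using h01.symm) hh hmono hh0 hh1 hplat
    rwa [MarkedDomain.pt_swap_zero, MarkedDomain.pt_swap_one] at h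
  refine ⟨⟨fun hD => ?_, fun hA => ?_⟩, fun hA => ?_, hF⟩
  · exact repar_lt_of_lt hh hmono hh0 hh1 hab hU (hiff.1 (hNP' hD))
  · exact repar_lt_of_lt hh hmono hh0 hh1 hab.symm hU' (hiff.2 (hNP hA))
  · have hB := hNP hA
    have hD := repar_lt_of_lt hh hmono hh0 hh1 hab.symm hU' (hiff.2 hB)
    rw [repar_attSet hh hmono hh0 hh1 hab.symm hU' hD.le, repar_attSet hh hmono hh0 hh1 hab hU hA.le]
    exact hS hB

/-! ### The theorem -/

/-- **`AttachReversal`, repaired**: reversal-equivariance of the canonical boundary attachment, for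
every self-avoiding walk of the discrete domain whose starting mesh point lies in `closure D` (in the
vocabulary of the Defs file; `attachReversal_iff` there certifies that these are the route's
`let`-blocks). -/
theorem attachReversal_of_mem_closure :
    ∀ (D : DobrushinDomain) (φ : ConformalEquiv upperHalfPlaneSet D.carrier), D.IsChordalUniformizing φ →
      ∀ (φ' : ConformalEquiv upperHalfPlaneSet D.swap.carrier), D.swap.IsChordalUniformizing φ' →
        ∀ (δ : ℝ) (u v : Site 2) (γ : SAW.DomainSAW D.carrier δ u v) (c c' : Curve ℂ), 0 < δ →
          meshPoint δ u ∈ closure D.carrier →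
          c ∈ standardCurves (D.pt 0) (D.pt 1) φ.boundaryExtension (min δ (1/2))
            (projLine (γ.walk.toCurve (meshPoint δ))) D.carrier →
          c' ∈ standardCurves (D.swap.pt 0) (D.swap.pt 1) φ'.boundaryExtension (min δ (1/2))
            (projLine (γ.walk.reverse.toCurve (meshPoint δ))) D.swap.carrier →
          CurveClass.mk c' = (CurveClass.mk c).reverse := by
  intro D φ hφ φ' hφ' δ u v γ c c' hδ hu h1 h2
  rw [MarkedDomain.pt_swap_zero, MarkedDomain.pt_swap_one] at h2
  obtain ⟨hiff, hS, hF⟩ := data_agree hφ hφ' γ hδ hu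
  exact mk_eq_reverse_of_range_eq h1.1 h2.1 h1.2.2.1 h2.2.1 (range_eq_of_data h1 h2 hiff hS hF)

/-- **`AttachReversal` for walks starting in the discrete domain** (every walk of positive length,
and the trivial walk at a vertex of `Ω_δ`). -/
theorem attachReversal_of_mem_meshDomain :
    ∀ (D : DobrushinDomain) (φ : ConformalEquiv upperHalfPlaneSet D.carrier), D.IsChordalUniformizing φ →
      ∀ (φ' : ConformalEquiv upperHalfPlaneSet D.swap.carrier), D.swap.IsChordalUniformizing φ' →
        ∀ (δ : ℝ) (u v : Site 2) (γ : SAW.DomainSAW D.carrier δ u v) (c c' : Curve ℂ), 0 < δ →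
          u ∈ meshDomain D.carrier δ →
          c ∈ standardCurves (D.pt 0) (D.pt 1) φ.boundaryExtension (min δ (1/2))
            (projLine (γ.walk.toCurve (meshPoint δ))) D.carrier →
          c' ∈ standardCurves (D.swap.pt 0) (D.swap.pt 1) φ'.boundaryExtension (min δ (1/2))
            (projLine (γ.walk.reverse.toCurve (meshPoint δ))) D.swap.carrier →
          CurveClass.mk c' = (CurveClass.mk c).reverse :=
  fun D φ hφ φ' hφ' δ u v γ c c' hδ hu =>
    attachReversal_of_mem_closure D φ hφ φ' hφ' δ u v γ c c' hδ
      (subset_closure (meshDomain_subset_meshVertices D.carrier δ hu))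

/-- **`AttachReversal` for walks with distinct endpoints** (as in the route's assembly, where the
lattice endpoints approximate the distinct marked points). -/
theorem attachReversal_of_ne :
    ∀ (D : DobrushinDomain) (φ : ConformalEquiv upperHalfPlaneSet D.carrier), D.IsChordalUniformizing φ →
      ∀ (φ' : ConformalEquiv upperHalfPlaneSet D.swap.carrier), D.swap.IsChordalUniformizing φ' →
        ∀ (δ : ℝ) (u v : Site 2) (γ : SAW.DomainSAW D.carrier δ u v) (c c' : Curve ℂ), 0 < δ → u ≠ v →
          c ∈ standardCurves (D.pt 0) (D.pt 1) φ.boundaryExtension (min δ (1/2))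
            (projLine (γ.walk.toCurve (meshPoint δ))) D.carrier →
          c' ∈ standardCurves (D.swap.pt 0) (D.swap.pt 1) φ'.boundaryExtension (min δ (1/2))
            (projLine (γ.walk.reverse.toCurve (meshPoint δ))) D.swap.carrier →
          CurveClass.mk c' = (CurveClass.mk c).reverse := by
  intro D φ hφ φ' hφ' δ u v γ c c' hδ huv
  refine attachReversal_of_mem_closure D φ hφ φ' hφ' δ u v γ c c' hδ (subset_closure ?_)
  have hn : 0 < γ.walk.length := by
    by_contra h
    exact huv (SimpleGraph.Walk.eq_of_length_eq_zero (Nat.eq_zero_of_not_pos h))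
  exact meshPoint_start_mem γ.walk hn


/-- **Endpoint approximations have eventually distinct lattice endpoints** (`meshPoint δ (a δ) → D.pt 0`,
`meshPoint δ (b δ) → D.pt 1`, `D.pt 0 ≠ D.pt 1`): the side condition of `attachReversal_of_ne` holds for
all small `δ` in the route's assembly. -/
theorem eventually_ne_of_isEndpointApprox {D : DobrushinDomain} {a b : ℝ → Site 2}
    (h : SAW.IsEndpointApprox D a b) : ∀ᶠ δ in nhdsWithin (0:ℝ) (Set.Ioi 0), a δ ≠ b δ := by
  have hab : D.pt 0 ≠ D.pt 1 := D.pt_injective.ne (by decide)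
  obtain ⟨U, V, hU, hV, haU, hbV, hUV⟩ := t2_separation hab
  filter_upwards [h.tendsto_fst (hU.mem_nhds haU), h.tendsto_snd (hV.mem_nhds hbV)] with δ ha hb
  intro heq
  have ha' : meshPoint δ (b δ) ∈ U := by rw [← heq]; exact ha
  exact Set.disjoint_left.1 hUV ha' hb

/-- **`AttachReversal`, repaired, in the route's literal form**: the text of
`Summit.CriticalPhenomena.SAWScalingLimit.Theses.SAWReversalUpgrade.AttachReversal` with the single
extra hypothesis `meshPoint δ u ∈ closure D.carrier` inserted after `0 < δ` (definitionally the
structured statement `attachReversal_of_mem_closure`). This is the corrected statement C′ proposed to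
the planner for the misstated item stmt-CriticalPhenomena-18007. -/
theorem attachReversal_repaired :
    ∀ (D : Literature.Probability.RandomPlanarGeometry.DobrushinDomain) (φ : Literature.Probability.RandomPlanarGeometry.ConformalEquiv UpperHalfPlane.upperHalfPlaneSet D.carrier), D.IsChordalUniformizing φ → ∀ (φ' : Literature.Probability.RandomPlanarGeometry.ConformalEquiv UpperHalfPlane.upperHalfPlaneSet D.swap.carrier), D.swap.IsChordalUniformizing φ' → ∀ (δ : ℝ) (u v : Literature.Probability.LatticeModels.Site 2) (γ : Literature.Probability.RandomPlanarGeometry.SAW.DomainSAW D.carrier δ u v) (c c' : Literature.Probability.RandomPlanarGeometry.Curve ℂ), 0 < δ → Literature.Probability.LatticeModels.meshPoint δ u ∈ closure D.carrier → (let a₁ := (D).pt 0; let b₁ := (D).pt 1; let P₁ : C(unitInterval, ℂ) := (γ.walk.toCurve (Literature.Probability.LatticeModels.meshPoint δ)); let R₁ := fun u : ℝ => P₁ (Set.projIcc (0:ℝ) 1 zero_le_one u); let φ₁ := (φ).boundaryExtension; let ψ₁ := Function.invFunOn φ₁ {z : ℂ | 0 ≤ z.im}; let e₁ : ℝ :=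 min δ (1/2); let A₁ := fun z : ℂ => (‖z‖ : ℂ) * Complex.exp (Complex.I * ((e₁ : ℂ) + (1 - 2 * (e₁ : ℂ) / (Real.pi : ℂ)) * (Complex.arg z : ℂ))); let Z₁ := fun u : ℝ => @ite ℂ (R₁ u = b₁) (Classical.propDecidable _) b₁ (φ₁ (A₁ (ψ₁ (R₁ u)))); let i₁ := sSup ({(0:ℝ)} ∪ {u | u ∈ Set.Icc (0:ℝ) 1 ∧ R₁ u = a₁}); let j₁ := sInf ({(1:ℝ)} ∪ {u | u ∈ Set.Icc (0:ℝ) 1 ∧ R₁ u = b₁}); let M₁ := Z₁ '' Set.Icc i₁ j₁; let p₁ := A₁ (ψ₁ (R₁ i₁)); let q₁ := A₁ (ψ₁ (R₁ j₁)); let s₁ := sInf {s | s ∈ Set.Ioc (0:ℝ) 1 ∧ φ₁ ((s : ℂ) * p₁) ∈ M₁}; let r₁ := sSup ({(1:ℝ)} ∪ {r | 1 ≤ r ∧ R₁ j₁ ≠ b₁ ∧ φ₁ ((r : ℂ) * q₁) ∈ M₁}); let u₁ := sInf {u | u ∈ Set.Icc i₁ j₁ ∧ Z₁ u = φ₁ ((s₁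 : ℂ) * p₁)}; let v₁ := sSup ({u | u ∈ Set.Icc i₁ j₁ ∧ R₁ j₁ = b₁ ∧ u = j₁} ∪ {u | u ∈ Set.Icc i₁ j₁ ∧ R₁ j₁ ≠ b₁ ∧ Z₁ u = φ₁ ((r₁ : ℂ) * q₁)}); let S₁ := ((({a₁, b₁} ∪ ((fun s : ℝ => φ₁ ((s : ℂ) * p₁)) '' Set.Ioc 0 s₁)) ∪ (Z₁ '' Set.Icc u₁ v₁)) ∪ ((fun r : ℝ => φ₁ ((r : ℂ) * q₁)) '' {r | r₁ ≤ r ∧ R₁ j₁ ≠ b₁})); Function.Injective (c) ∧ (c).source = a₁ ∧ (c).target = b₁ ∧ (∀ t : unitInterval, (c) t = a₁ ∨ (c) t = b₁ ∨ (c) t ∈ (D).carrier) ∧ (u₁ < v₁ → Set.range (c) = S₁) ∧ (¬ u₁ < v₁ → Set.range (c) = {a₁, b₁} ∪ ((fun y : ℝ => φ₁ (Complex.I * (y : ℂ))) '' Set.Ioi 0))) → (let a₁ := (D.swap).pt 0; let b₁ := (D.swap).pt 1; let P₁ : C(unitInterval, ℂ) := (γ.walk.reverse.toCurve (Literature.Probability.LatticeModels.meshPoint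 δ)); let R₁ := fun u : ℝ => P₁ (Set.projIcc (0:ℝ) 1 zero_le_one u); let φ₁ := (φ').boundaryExtension; let ψ₁ := Function.invFunOn φ₁ {z : ℂ | 0 ≤ z.im}; let e₁ : ℝ := min δ (1/2); let A₁ := fun z : ℂ => (‖z‖ : ℂ) * Complex.exp (Complex.I * ((e₁ : ℂ) + (1 - 2 * (e₁ : ℂ) / (Real.pi : ℂ)) * (Complex.arg z : ℂ))); let Z₁ := fun u : ℝ => @ite ℂ (R₁ u = b₁) (Classical.propDecidable _) b₁ (φ₁ (A₁ (ψ₁ (R₁ u)))); let i₁ := sSup ({(0:ℝ)} ∪ {u | u ∈ Set.Icc (0:ℝ) 1 ∧ R₁ u = a₁}); let j₁ := sInf ({(1:ℝ)} ∪ {u | u ∈ Set.Icc (0:ℝ) 1 ∧ R₁ u = b₁}); let M₁ := Z₁ '' Set.Icc i₁ j₁; let p₁ := A₁ (ψ₁ (R₁ i₁)); let q₁ := A₁ (ψ₁ (R₁ j₁)); let s₁ := sInf {s | s ∈ Set.Ioc (0:ℝ) 1 ∧ φ₁ ((s : ℂ) * p₁) ∈ M₁}; let r₁ := sSup ({(1:ℝ)}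 ∪ {r | 1 ≤ r ∧ R₁ j₁ ≠ b₁ ∧ φ₁ ((r : ℂ) * q₁) ∈ M₁}); let u₁ := sInf {u | u ∈ Set.Icc i₁ j₁ ∧ Z₁ u = φ₁ ((s₁ : ℂ) * p₁)}; let v₁ := sSup ({u | u ∈ Set.Icc i₁ j₁ ∧ R₁ j₁ = b₁ ∧ u = j₁} ∪ {u | u ∈ Set.Icc i₁ j₁ ∧ R₁ j₁ ≠ b₁ ∧ Z₁ u = φ₁ ((r₁ : ℂ) * q₁)}); let S₁ := ((({a₁, b₁} ∪ ((fun s : ℝ => φ₁ ((s : ℂ) * p₁)) '' Set.Ioc 0 s₁)) ∪ (Z₁ '' Set.Icc u₁ v₁)) ∪ ((fun r : ℝ => φ₁ ((r : ℂ) * q₁)) '' {r | r₁ ≤ r ∧ R₁ j₁ ≠ b₁})); Function.Injective (c') ∧ (c').source = a₁ ∧ (c').target = b₁ ∧ (∀ t : unitInterval, (c') t = a₁ ∨ (c') t = b₁ ∨ (c') t ∈ (D.swap).carrier) ∧ (u₁ < v₁ → Set.range (c') = S₁) ∧ (¬ u₁ < v₁ → Set.range (c') = {a₁, b₁} ∪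 ((fun y : ℝ => φ₁ (Complex.I * (y : ℂ))) '' Set.Ioi 0))) → Literature.Probability.RandomPlanarGeometry.CurveClass.mk c' = (Literature.Probability.RandomPlanarGeometry.CurveClass.mk c).reverse :=
  attachReversal_of_mem_closure

end Summit.CriticalPhenomena.SAWScalingLimit.Theorems.AttachReversal

end
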